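import Literature.AlgebraicGeometry.ModuliOfAbelianVarieties.SiegelFamilyHumbertTraceForm
import Literature.AlgebraicGeometry.ModuliOfAbelianVarieties.SiegelFamilyHumbertQCMSimplicity
import HarnessLib

/-!
# The order `ℤ[α, β] = ℤ ⊕ ℤα ⊕ ℤβ ⊕ ℤαβ` of a pair of singular relations, its discriminant
# `d(ℤ[α, β]) = det(S_Δ)/4`, Runge's saturation criterion `g.c.d.(b, c) = 1 ⟹ ℚ(α, β) ∩ M₄(ℤ) = ℤ[α, β]` (for `α` in
# Humbert's normal form), and then the QCM-order `End(X_Z) = ℤ[α, β]` at the simple points of `H_q ∩ H_{q′}`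
# (Runge 1999, §6 Thm. 7 and Cor. 9)

Layer `Literature/AlgebraicGeometry/ModuliOfAbelianVarieties`, namespace
`Literature.AlgebraicGeometry.ModuliOfAbelianVarieties.SiegelModuli`; lane `lit-hodgefound` (Track 2 foundations
library, Layer A4), seat `lit-hodgefound-skel-4`, row **A4-67**, FILE 2. Sequel of FILE 1 (`SiegelFamilyHumbertTraceForm`:
Runge's trace form on `ℚ(α, β)`, the Gram matrix `pairGram` of `(1, α, β, αβ)`, `d(1, α, β, αβ)² = (det S_Δ/4)²`,
`linearIndependent_humbertPairFam`), of row A4-66 FILE 3 (`SiegelFamilyTwoHumbertSurfaces`: `S_Δ = discMatrix q q′` is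
positive definite at a point of `H_q ∩ H_{q′} ⊂ 𝔥₂`, `ℚ(α, β) ⊆ End_ℚ(X_Z) ⟺ Z ∈ H_q ∩ H_{q′}`,
`End_ℚ(X_Z) = ℚ(α, β)` for simple `X_Z`) and FILE 5 (`SiegelFamilyHumbertQCMSimplicity`: `End_ℚ(X_Z) = ℚ(α, β)` when
`ρ(X_Z) = 3`).

## Source followed, verbatim (B. Runge, *Endomorphism rings of abelian surfaces and projective models of their moduli
## spaces*, Tohoku Math. J. 51 (1999), held text `paper:doi-10-2748-tmj-1178224764`, §6 pp. 294–296)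

* p. 294: "We recall that an order `R` in an indefinite rational quaternion algebra `A = R ⊗ ℚ` is called a QCM-order if
  `R = End(X)` for some abelian surface `X`. This is equivalent to that `L = R ⊗ ℚ` is admissible and `R = L ∩ M₄(ℤ)`
  for some Rosati equivariant embedding `L ⊂ M₄(ℚ)`."
* pp. 294–295, **THEOREM 7.** "Any QCM-order can be written as `R = ℤ ⊕ ℤα ⊕ ℤβ ⊕ ℤαβ`, where `α` and `β` are primitive
  Rosati invariant elements of positive discriminant `Δ(α)`, `Δ(β)`, such that the discriminant matrix
  `S_Δ = (Δ(α) Δ(α,β); Δ(α,β) Δ(β))` is positive definite. The discriminant of `R` is `d(R) = det(S_Δ)/4`."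
  Proof, p. 295: "Since we have `R = R ⊗ ℚ ∩ M₄(ℤ)`, we may assume that `α` and `β` are primitive normalized
  elements of `R`. By Theorem 2 we may assume that (`α`, `β`) are as follows:
  `α = (0 k 0 0; 1 l 0 0; 0 0 0 1; 0 0 k l)`, `β = (a₁ a₂ 0 b; a₃ a₄ −b 0; 0 c a₁ a₃; −c 0 a₂ a₄)`. […] Hence we may assume
  that the `g.c.d.(b, c) = 1` for a basis `(α, β)`. Now it is easy to check that `g.c.d.(b, c) = 1` for a basis `(α, β)`
  implies that `ℚ(α, β) ∩ M₄(ℤ) = ℤ ⊕ ℤα ⊕ ℤβ ⊕ ℤαβ`. The computation of the discriminant is omitted."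
* p. 296, proof of **COROLLARY 9**: "By Lemma 8 the elements `α` and `β` generate an order contained in `R`, which
  generates the same quaternion algebra `ℚ(α, β) = R ⊗ ℚ`. Therefore `ℤ[α, β]` is a QCM-order." and p. 296: "For any
  closed point `τ` of the QCM-curve `C(R)` outside a set of measure zero (i.e., outside a countable set) we have
  `End(A_τ) = R`."

Runge's normal form `α = (0 k 0 0; 1 l 0 0; 0 0 0 1; 0 0 k l)` is B–W's `R₀(q₀)` for Humbert's normal form
`q₀ = humbertNormalForm k l = (k, l, −1, 0, 0)` (row A4-64; `A = (0 a; −c b) = (0 k; 1 l)`, `B = C = 0`), and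
`β = (A′ B′; C′ ᵗA′)` with `B′ = b(0 1; −1 0)`, `C′ = c(0 1; −1 0)` has Runge's `b = q′₃ = d′`, `c = q′₄ = e′` (the
antisymmetric-block entries). "`ℚ(α, β) ∩ M₄(ℤ)`" is the subring `humbertPairAlgInt q q′` (pull-back of row A4-66's
`ℚ(α, β)` along `M₄(ℤ) → M₄(ℚ)`, the same construction as row A2-31's `endRingInt = End_ℚ(X) ∩ M₄(ℤ)`).

## Contents (definitions with bodies and proved theorems; NO named fact, net debt 0)

For two relation vectors `q, q′ ∈ ℤ⁵` with B–W matrices `α = R₀(q)`, `β = R₀(q′) ∈ M₄(ℤ)` (row A4-59′ `humbertRatRep`;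
every Rosati-invariant integer matrix is `X(n, q) = n·1 + R₀(q)`, row A4-65 FILE 3):
* §1 **`humbertPairOrder q q′ = ℤ[α, β]`** `:= Algebra.adjoin ℤ {α, β} ⊆ M₄(ℤ)` and
  **`humbertPairOrder_toSubmodule_eq_span`**: `ℤ[α, β] = ℤ1 + ℤα + ℤβ + ℤαβ` for EVERY pair — "By Lemma 8 the elements
  `α` and `β` generate an order" (the `ℤ`-span of `1, α, β, αβ` is multiplicatively closed by B–W's `α² = bα − (ac+de)`,
  Runge's Lemma 8 over `ℤ` and FILE 1's `α(αβ)`, `β(αβ)`, `(αβ)²` identities); `rosatiMatrix_mem_humbertPairOrder`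
  (`ℤ[X(m,q), X(n,q′)] = ℤ[α, β]`), `humbertComm_mem_humbertPairOrder` (`γ ∈ ℤ[α, β]`), `exists_eq_comb_of_mem_humbertPairOrder`.
* §2 **THEOREM 7's shape `R = ℤ ⊕ ℤα ⊕ ℤβ ⊕ ℤαβ`** for `R = ℤ[α, β]` whenever `det S_Δ ≠ 0`:
  `linearIndependent_humbertPairFamInt`, **`humbertPairOrderBasis`** (a `ℤ`-basis `(1, α, β, αβ)`),
  `finrank_humbertPairOrder` (`= 4`), `existsUnique_coords_of_mem_humbertPairOrder`.
* §3 "which generates the same quaternion algebra `ℚ(α, β) = R ⊗ ℚ`": `map_mem_humbertPairAlg_of_mem`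
  (`ℤ[α, β] ⊆ ℚ(α, β)`), **`exists_int_smul_eq_map_of_mem_humbertPairAlg`** (every element of `ℚ(α, β)` has a non-zero
  integer multiple in `ℤ[α, β]`: a full `ℤ`-lattice), `span_rat_map_humbertPairOrder` (`ℚ·ℤ[α, β] = ℚ(α, β)`).
* §4 the discriminant of `R = ℤ[α, β]`: **`pairDiscr q q′ := det(S_Δ)/4 = −γ²`** (an integer, `four_mul_pairDiscr`) with
  **`pairDiscr_sq_eq_rungeDiscrSq`** (`(det S_Δ/4)² = d(1, α, β, αβ)² = −det(t(xᵢxⱼ))`, FILE 1) — Runge's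
  "`d(R) = det(S_Δ)/4`" with "the positive sign": **`pairDiscr_pos`** at every point of `H_q ∩ H_{q′}` (`S_Δ` positive
  definite, row A4-66 FILE 3), so there `d(ℤ[α, β]) = det(S_Δ)/4 ∈ ℕ_{>0}` (`exists_nat_pairDiscr`).
* §5 on `𝔥₂`: **`humbertPairOrder_le_endRingInt_iff`** — `ℤ[α, β] ⊆ ρ_r(End(X_Z)) ⟺ Z ∈ H_q ∩ H_{q′}` (B–W Cor. 4.2 for
  each generator), and at such a point with `ℚ`-independent relations: the `ℤ`-basis, `rank 4`, `d = det(S_Δ)/4 > 0`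
  (`humbertPairOrder_summary`).
* §6 complements to FILE 1 on `A = ℚ(α, β)`: the "main anti-involution" `rungeBar x = t(x)·1 − x` with
  **`rungeBar_mul_rev_of_mem`** (`(xy)‾ = ȳx̄`), `mul_rungeBar_add_mul_rungeBar` ("`n(x, y) = xȳ + yx̄`"),
  **`rungeNorm_mul_of_mem`** ("the map `n : A → ℚ` is multiplicative"), `rungeNorm_rungeBar`.
* §7 `humbertPairAlgInt = ℚ(α, β) ∩ M₄(ℤ)`, `mem_humbertPairAlgInt_iff`, `humbertPairOrder_le_humbertPairAlgInt`
  (`ℤ[α, β] ⊆ ℚ(α, β) ∩ M₄(ℤ)` for every pair).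
* §8 **`mem_humbertPairOrder_of_map_mem_humbertPairAlg`** / **`humbertPairAlgInt_normalForm_eq`** — Runge's "easy check":
  for `α = R₀(humbertNormalForm k l)` and `g.c.d.(d′, e′) = 1` (`IsCoprime (q′ 3) (q′ 4)`),
  `ℚ(α, β) ∩ M₄(ℤ) = ℤ[α, β] = ℤ ⊕ ℤα ⊕ ℤβ ⊕ ℤαβ`: reading the coefficients `c₀, …, c₃` of an integer matrix
  `c₀·1 + c₁α + c₂β + c₃αβ` off the entries `c₃d′`, `c₂d′`, `c₂e′`, `−c₃e′`, `c₁ − (c₂ + lc₃)c′`, `c₀ − kc′c₃`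
  (`comb_normalForm_entries`).
* §9 on `𝔥₂` (`Z ∈ H_{q₀} ∩ H_{q′}`, `q₀` the normal form, `g.c.d.(d′, e′) = 1`): **`endRingInt_inf_humbertPairAlgInt_eq`**
  (`ρ_r(End(X_Z)) ∩ ℚ(α, β) = ℤ[α, β]`), and where `End_ℚ(X_Z) = ℚ(α, β)` — at the SIMPLE points (row A4-66 FILE 3) and
  at the points with `ρ(X_Z) = 3` (row A4-66 FILE 5) — **`endRingInt_eq_humbertPairOrder_of_isSimple`** /
  **`…_of_finrank_eq_three`** and **`runge_theorem_seven_of_isSimple`**: `ρ_r(End(X_Z)) = ℤ ⊕ ℤα ⊕ ℤβ ⊕ ℤαβ` with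
  `End_ℚ(X_Z) = ℚ(α, β)` and discriminant `d = det(S_Δ)/4 > 0`, `d² = −det(t(xᵢxⱼ))` — THEOREM 7 as printed for these
  QCM-orders.

## Scope

* NOT claimed: the existence half of Theorem 7 for an ABSTRACT QCM-order `R = End(X)` (Runge's Dirichlet-type
  normalisation, choosing primes `p₁, p₂` to reach `g.c.d.(b, c) = 1` inside `R`), the measure-zero statement
  "`End(A_τ) = R` outside a countable set" (§9 gives `End = ℤ[α, β]` under the explicit hypotheses `IsSimple X_Z` or
  `ρ(X_Z) = 3` of rows A4-66 F3/F5), Cor. 9 (i)⇔(ii)⇔(iii) and the QCM-curves `C(R) ⊂ 𝔥₂`.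
* The saturation criterion is proved as printed — an implication, for `α` in Humbert's normal form ("By Theorem 2 we
  may assume"; the transport to an arbitrary primitive `α` by `Sp₄(ℤ)`, row A4-65, is not spelled out); numerically it
  is sufficient, not necessary (there are saturated pairs with `g.c.d.(d′, e′) > 1`).
* `d(R)` is recorded as the INTEGER `pairDiscr q q′ = det(S_Δ)/4` whose square is Runge's `d² = −det(t(xᵢxⱼ))` and which
  is positive on `H_q ∩ H_{q′}`; no real square root is taken.

## References

* [Runge1999EndomorphismRingsAbelianSurfaces] B. Runge, *Endomorphism rings of abelian surfaces and projective models of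
  their moduli spaces*, Tohoku Math. J. 51 (1999) 283–303, §6 pp. 294–296 (Thm. 7, Lemma 8, Cor. 9).
* [BirkenhakeWilhelm2003] Ch. Birkenhake, H. Wilhelm, *Humbert surfaces and the Kummer plane*, Trans. AMS 355 (2003),
  §4 Cor. 4.2, Prop. 4.3, Cor. 4.4 (pp. 1827–1828).
-/

noncomputable section

open Matrix Module Function

namespace Literature.AlgebraicGeometry.ModuliOfAbelianVarieties

namespace SiegelModuli

open Literature.NumberTheory.Automorphic (siegelUpperHalfSpace)
open Literature.NumberTheory.ModularForms.SiegelUpperHalfSpace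
open Literature.Geometry.Kaehler Literature.Geometry.Kaehler.ComplexTorus
open Sum

/-- `M₄(ℤ)` on the index set `Fin 2 ⊕ Fin 2`. -/
local notation "𝕄ℤ" => Matrix (Fin 2 ⊕ Fin 2) (Fin 2 ⊕ Fin 2) ℤ
/-- `M₄(ℚ)` on the index set `Fin 2 ⊕ Fin 2`. -/
local notation "𝕄" => Matrix (Fin 2 ⊕ Fin 2) (Fin 2 ⊕ Fin 2) ℚ

/-! ## §0 Casting bookkeeping -/

section Cast

variable {ι : Type*}

/-- Casting commutes with products. [folklore] -/
private theorem castQ_mul [Fintype ι] (A B : Matrix ι ι ℤ) :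
    (A * B).map (Int.cast : ℤ → ℚ) = A.map (Int.cast : ℤ → ℚ) * B.map (Int.cast : ℤ → ℚ) := by
  ext i j; simp [Matrix.mul_apply]

/-- Casting preserves `1`. [folklore] -/
private theorem castQ_one [DecidableEq ι] : (1 : Matrix ι ι ℤ).map (Int.cast : ℤ → ℚ) = 1 := by
  ext i j; simp [Matrix.one_apply]

/-- Casting commutes with integer scalars. [folklore] -/
private theorem castQ_smul (c : ℤ) (A : Matrix ι ι ℤ) :
    (c • A).map (Int.cast : ℤ → ℚ) = (c : ℚ) • A.map (Int.cast : ℤ → ℚ) := by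
  ext i j; simp

/-- Casting commutes with sums. [folklore] -/
private theorem castQ_add (A B : Matrix ι ι ℤ) :
    (A + B).map (Int.cast : ℤ → ℚ) = A.map (Int.cast : ℤ → ℚ) + B.map (Int.cast : ℤ → ℚ) := by
  ext i j; simp

/-- The cast is injective. [folklore] -/
private theorem castQ_injective : Function.Injective (fun A : Matrix ι ι ℤ ↦ A.map (Int.cast : ℤ → ℚ)) :=
  fun A B h ↦ Matrix.ext fun i j ↦ by
    have := congrFun (congrFun h i) j
    simpa using this

/-- The entrywise cast `M₄(ℤ) → M₄(ℚ)` as a `ℤ`-linear map. [folklore] -/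
private def castLin : 𝕄ℤ →ₗ[ℤ] 𝕄 := ((Int.castRingHom ℚ).mapMatrix : 𝕄ℤ →+* 𝕄).toAddMonoidHom.toIntLinearMap

/-- `castLin A = A.map Int.cast`. [folklore] -/
private theorem castLin_apply (A : 𝕄ℤ) : castLin A = A.map (Int.cast : ℤ → ℚ) := rfl

end Cast

variable (q q' : Fin 5 → ℤ)

/-! ## §1 The order `ℤ[α, β]` and "`α` and `β` generate an order": `ℤ[α, β] = ℤ1 + ℤα + ℤβ + ℤαβ` -/

section Order

/-- **`ℤ[α, β]`: the sub-`ℤ`-algebra of `M₄(ℤ)` generated by the B–W matrices `α = R₀(q)`, `β = R₀(q′)` of two singular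
relations** — Runge's "the elements `α` and `β` generate an order" (it contains every Rosati matrix `X(m, q) = m·1 + R₀(q)`,
`X(n, q′)`, `rosatiMatrix_mem_humbertPairOrder`). [cite: Runge1999EndomorphismRingsAbelianSurfaces, §6 proof of Cor. 9 (p. 296: "the elements `α` and `β` generate an order … Therefore `ℤ[α, β]` is a QCM-order")] -/
def humbertPairOrder (q q' : Fin 5 → ℤ) : Subalgebra ℤ (Matrix (Fin 2 ⊕ Fin 2) (Fin 2 ⊕ Fin 2) ℤ) :=
  Algebra.adjoin ℤ {humbertRatRep q, humbertRatRep q'}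

/-- Unfolding of `humbertPairOrder`. [cite: Runge1999EndomorphismRingsAbelianSurfaces, §6 proof of Cor. 9 (p. 296)] -/
theorem humbertPairOrder_def : humbertPairOrder q q' = Algebra.adjoin ℤ {humbertRatRep q, humbertRatRep q'} := rfl

/-- `α ∈ ℤ[α, β]`. [cite: Runge1999EndomorphismRingsAbelianSurfaces, §6 proof of Cor. 9 (p. 296)] -/
theorem humbertRatRep_mem_humbertPairOrder_left : humbertRatRep q ∈ humbertPairOrder q q' :=
  Algebra.subset_adjoin (Set.mem_insert _ _)

/-- `β ∈ ℤ[α, β]`. [cite: Runge1999EndomorphismRingsAbelianSurfaces, §6 proof of Cor. 9 (p. 296)] -/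
theorem humbertRatRep_mem_humbertPairOrder_right : humbertRatRep q' ∈ humbertPairOrder q q' :=
  Algebra.subset_adjoin (Set.mem_insert_of_mem _ rfl)

/-- `ℤ[α, β] = ℤ[β, α]`. [cite: Runge1999EndomorphismRingsAbelianSurfaces, §6 proof of Cor. 9 (p. 296)] -/
theorem humbertPairOrder_comm : humbertPairOrder q q' = humbertPairOrder q' q := by
  rw [humbertPairOrder, humbertPairOrder, Set.pair_comm]

/-- Every Rosati matrix `X(m, q) = m·1 + R₀(q)` lies in `ℤ[α, β]` (so `ℤ[X(m,q), X(n,q′)] = ℤ[α, β]`).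
[cite: Runge1999EndomorphismRingsAbelianSurfaces, §4 p. 288 and §6 proof of Cor. 9 (p. 296)] -/
theorem rosatiMatrix_mem_humbertPairOrder (m : ℤ) : rosatiMatrix m q ∈ humbertPairOrder q q' := by
  rw [rosatiMatrix_eq_smul_one_add]
  exact add_mem (Subalgebra.smul_mem _ (one_mem _) _) (humbertRatRep_mem_humbertPairOrder_left q q')

/-- `X(n, q′) ∈ ℤ[α, β]`. [cite: Runge1999EndomorphismRingsAbelianSurfaces, §4 p. 288 and §6 proof of Cor. 9 (p. 296)] -/
theorem rosatiMatrix_mem_humbertPairOrder' (n : ℤ) : rosatiMatrix n q' ∈ humbertPairOrder q q' := by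
  rw [humbertPairOrder_comm]; exact rosatiMatrix_mem_humbertPairOrder q' q n

/-- `αβ ∈ ℤ[α, β]`. [cite: Runge1999EndomorphismRingsAbelianSurfaces, §6 proof of Cor. 9 (p. 296)] -/
theorem humbertRatRep_mul_mem_humbertPairOrder : humbertRatRep q * humbertRatRep q' ∈ humbertPairOrder q q' :=
  mul_mem (humbertRatRep_mem_humbertPairOrder_left q q') (humbertRatRep_mem_humbertPairOrder_right q q')

/-- **`γ = αβ − βα ∈ ℤ[α, β]`.** [cite: Runge1999EndomorphismRingsAbelianSurfaces, §6 proof of Thm. 7 (p. 295)] -/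
theorem humbertComm_mem_humbertPairOrder : humbertComm q q' ∈ humbertPairOrder q q' := by
  rw [humbertComm_def]
  exact sub_mem (humbertRatRep_mul_mem_humbertPairOrder q q')
    (mul_mem (humbertRatRep_mem_humbertPairOrder_right q q') (humbertRatRep_mem_humbertPairOrder_left q q'))

/-- `2α − b·1 ∈ ℤ[α, β]` (the square root of `Δ(q)`). [cite: Runge1999EndomorphismRingsAbelianSurfaces, §4 p. 288] -/
theorem humbertSqrt_mem_humbertPairOrder : humbertSqrt q ∈ humbertPairOrder q q' := by
  rw [humbertSqrt_def]
  exact sub_mem (Subalgebra.smul_mem _ (humbertRatRep_mem_humbertPairOrder_left q q') _)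
    (Subalgebra.smul_mem _ (one_mem _) _)

/-- **The integer spanning family `(1, α, β, αβ)` of `ℤ[α, β]`** (casts to FILE 1's `humbertPairFam`).
[cite: Runge1999EndomorphismRingsAbelianSurfaces, §6 Thm. 7 (p. 294: "`R = ℤ ⊕ ℤα ⊕ ℤβ ⊕ ℤαβ`")] -/
def humbertPairFamInt (q q' : Fin 5 → ℤ) : Fin 4 → 𝕄ℤ :=
  ![1, humbertRatRep q, humbertRatRep q', humbertRatRep q * humbertRatRep q']

/-- `x₁ = 1`. [folklore] -/
@[simp] private theorem humbertPairFamInt_zero : humbertPairFamInt q q' 0 = 1 := rfl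
/-- `x₂ = α`. [folklore] -/
@[simp] private theorem humbertPairFamInt_one : humbertPairFamInt q q' 1 = humbertRatRep q := rfl
/-- `x₃ = β`. [folklore] -/
@[simp] private theorem humbertPairFamInt_two : humbertPairFamInt q q' 2 = humbertRatRep q' := rfl
/-- `x₄ = αβ`. [folklore] -/
@[simp] private theorem humbertPairFamInt_three : humbertPairFamInt q q' 3 = humbertRatRep q * humbertRatRep q' := rfl

/-- The integer family casts to the rational family of FILE 1. [cite: Runge1999EndomorphismRingsAbelianSurfaces, §6 Thm. 7 (p. 294)] -/
theorem map_humbertPairFamInt (i : Fin 4) :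
    (humbertPairFamInt q q' i).map (Int.cast : ℤ → ℚ) = humbertPairFam q q' i := by
  fin_cases i
  · exact castQ_one
  · rfl
  · rfl
  · exact castQ_mul _ _

/-- Each member of the family lies in `ℤ[α, β]`. [cite: Runge1999EndomorphismRingsAbelianSurfaces, §6 proof of Cor. 9 (p. 296)] -/
theorem humbertPairFamInt_mem (i : Fin 4) : humbertPairFamInt q q' i ∈ humbertPairOrder q q' := by
  fin_cases i
  · exact one_mem _
  · exact humbertRatRep_mem_humbertPairOrder_left q q'
  · exact humbertRatRep_mem_humbertPairOrder_right q q'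
  · exact humbertRatRep_mul_mem_humbertPairOrder q q'

/-- Spanning-set bookkeeping. [folklore] -/
private theorem mem_span_fam (i : Fin 4) :
    humbertPairFamInt q q' i ∈ Submodule.span ℤ (Set.range (humbertPairFamInt q q')) :=
  Submodule.subset_span ⟨i, rfl⟩

/-- An integer combination `c₀·1 + c₁α + c₂β + c₃αβ` lies in the span. [folklore] -/
private theorem comb_mem_span (c₀ c₁ c₂ c₃ : ℤ) :
    c₀ • (1 : 𝕄ℤ) + c₁ • humbertRatRep q + c₂ • humbertRatRep q' + c₃ • (humbertRatRep q * humbertRatRep q') ∈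
      Submodule.span ℤ (Set.range (humbertPairFamInt q q')) :=
  add_mem (add_mem (add_mem (Submodule.smul_mem _ _ (mem_span_fam q q' 0))
    (Submodule.smul_mem _ _ (mem_span_fam q q' 1))) (Submodule.smul_mem _ _ (mem_span_fam q q' 2)))
    (Submodule.smul_mem _ _ (mem_span_fam q q' 3))

/-- `βα = −αβ + bβ + b′α − N·1` over `ℤ` (Lemma 8 rearranged). [cite: Runge1999EndomorphismRingsAbelianSurfaces, §6 Lemma 8 (p. 295)] -/
theorem humbertRatRep_mul_swap (q q' : Fin 5 → ℤ) :
    humbertRatRep q' * humbertRatRep q =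
      -(humbertRatRep q * humbertRatRep q') + q 1 • humbertRatRep q' + q' 1 • humbertRatRep q -
        humbertNormPolar q q' • (1 : 𝕄ℤ) := by
  rw [← sub_eq_iff_eq_add'.2 (humbertRatRep_mul_add_mul q q').symm]
  abel

/-- Left multiplication by `α` preserves the span (uses `α² = bα − (ac+de)·1`). [folklore] -/
private theorem mul_left_mem_span_left {y : 𝕄ℤ} (hy : y ∈ Submodule.span ℤ (Set.range (humbertPairFamInt q q'))) :
    humbertRatRep q * y ∈ Submodule.span ℤ (Set.range (humbertPairFamInt q q')) := by
  induction hy using Submodule.span_induction with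
  | mem x hx =>
    obtain ⟨i, rfl⟩ := hx
    have hsq := humbertRatRep_mul_self q
    fin_cases i
    · simpa using mem_span_fam q q' 1
    · have : humbertRatRep q * humbertRatRep q = (-(q 0 * q 2 + q 3 * q 4)) • (1 : 𝕄ℤ) +
          q 1 • humbertRatRep q + (0 : ℤ) • humbertRatRep q' + (0 : ℤ) • (humbertRatRep q * humbertRatRep q') := by
        rw [hsq]; module
      show humbertRatRep q * humbertRatRep q ∈ _
      rw [this]; exact comb_mem_span q q' _ _ _ _
    · simpa using mem_span_fam q q' 3
    · have : humbertRatRep q * (humbertRatRep q * humbertRatRep q') = (0 : ℤ) • (1 : 𝕄ℤ) + (0 : ℤ) • humbertRatRep q +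
          (-(q 0 * q 2 + q 3 * q 4)) • humbertRatRep q' + q 1 • (humbertRatRep q * humbertRatRep q') := by
        rw [← mul_assoc, hsq, sub_mul, smul_mul_assoc, smul_mul_assoc, one_mul]
        module
      show humbertRatRep q * (humbertRatRep q * humbertRatRep q') ∈ _
      rw [this]; exact comb_mem_span q q' _ _ _ _
  | zero => rw [mul_zero]; exact zero_mem _
  | add x y _ _ hx hy => rw [mul_add]; exact add_mem hx hy
  | smul c x _ hx => rw [mul_smul_comm]; exact Submodule.smul_mem _ _ hx

/-- Left multiplication by `β` preserves the span (Lemma 8 and `β² = b′β − (a′c′+d′e′)·1`). [folklore] -/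
private theorem mul_left_mem_span_right {y : 𝕄ℤ} (hy : y ∈ Submodule.span ℤ (Set.range (humbertPairFamInt q q'))) :
    humbertRatRep q' * y ∈ Submodule.span ℤ (Set.range (humbertPairFamInt q q')) := by
  induction hy using Submodule.span_induction with
  | mem x hx =>
    obtain ⟨i, rfl⟩ := hx
    have hsq' := humbertRatRep_mul_self q'
    have hsw := humbertRatRep_mul_swap q q'
    fin_cases i
    · simpa using mem_span_fam q q' 2
    · have : humbertRatRep q' * humbertRatRep q = (-humbertNormPolar q q') • (1 : 𝕄ℤ) +
          q' 1 • humbertRatRep q + q 1 • humbertRatRep q' + (-1 : ℤ) • (humbertRatRep q * humbertRatRep q') := by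
        rw [hsw]; module
      show humbertRatRep q' * humbertRatRep q ∈ _
      rw [this]; exact comb_mem_span q q' _ _ _ _
    · have : humbertRatRep q' * humbertRatRep q' = (-(q' 0 * q' 2 + q' 3 * q' 4)) • (1 : 𝕄ℤ) +
          (0 : ℤ) • humbertRatRep q + q' 1 • humbertRatRep q' + (0 : ℤ) • (humbertRatRep q * humbertRatRep q') := by
        rw [hsq']; module
      show humbertRatRep q' * humbertRatRep q' ∈ _
      rw [this]; exact comb_mem_span q q' _ _ _ _
    · have : humbertRatRep q' * (humbertRatRep q * humbertRatRep q') =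
          (-(q 1 * (q' 0 * q' 2 + q' 3 * q' 4))) • (1 : 𝕄ℤ) + (q' 0 * q' 2 + q' 3 * q' 4) • humbertRatRep q +
          (q 1 * q' 1 - humbertNormPolar q q') • humbertRatRep q' + (0 : ℤ) • (humbertRatRep q * humbertRatRep q') := by
        rw [← mul_assoc, hsw]
        simp only [add_mul, sub_mul, neg_mul, smul_mul_assoc, one_mul, mul_assoc]
        rw [hsq']
        simp only [mul_sub, mul_smul_comm, mul_one, smul_sub, smul_smul]
        module
      show humbertRatRep q' * (humbertRatRep q * humbertRatRep q') ∈ _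
      rw [this]; exact comb_mem_span q q' _ _ _ _
  | zero => rw [mul_zero]; exact zero_mem _
  | add x y _ _ hx hy => rw [mul_add]; exact add_mem hx hy
  | smul c x _ hx => rw [mul_smul_comm]; exact Submodule.smul_mem _ _ hx

/-- The span of `1, α, β, αβ` is closed under multiplication. [folklore] -/
private theorem mul_mem_span {x y : 𝕄ℤ} (hx : x ∈ Submodule.span ℤ (Set.range (humbertPairFamInt q q')))
    (hy : y ∈ Submodule.span ℤ (Set.range (humbertPairFamInt q q'))) :
    x * y ∈ Submodule.span ℤ (Set.range (humbertPairFamInt q q')) := by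
  induction hx using Submodule.span_induction with
  | mem x hx =>
    obtain ⟨i, rfl⟩ := hx
    fin_cases i
    · simpa using hy
    · simpa using mul_left_mem_span_left q q' hy
    · simpa using mul_left_mem_span_right q q' hy
    · show humbertRatRep q * humbertRatRep q' * y ∈ _
      rw [mul_assoc]
      exact mul_left_mem_span_left q q' (mul_left_mem_span_right q q' hy)
  | zero => rw [zero_mul]; exact zero_mem _
  | add x₁ x₂ _ _ h₁ h₂ => rw [add_mul]; exact add_mem h₁ h₂
  | smul c x _ hx => rw [smul_mul_assoc]; exact Submodule.smul_mem _ _ hx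

/-- **"By Lemma 8 the elements `α` and `β` generate an order": `ℤ[α, β] = ℤ1 + ℤα + ℤβ + ℤαβ`** — the `ℤ`-span of
`1, α, β, αβ` is a subring (for EVERY pair of relations). [cite: Runge1999EndomorphismRingsAbelianSurfaces, §6 proof of Cor. 9 (p. 296) and Thm. 7 (p. 294: "`R = ℤ ⊕ ℤα ⊕ ℤβ ⊕ ℤαβ`")] -/
theorem humbertPairOrder_toSubmodule_eq_span :
    Subalgebra.toSubmodule (humbertPairOrder q q') = Submodule.span ℤ (Set.range (humbertPairFamInt q q')) := by
  let S : Subalgebra ℤ 𝕄ℤ :=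
    (Submodule.span ℤ (Set.range (humbertPairFamInt q q'))).toSubalgebra (mem_span_fam q q' 0)
      (fun x y hx hy ↦ mul_mem_span q q' hx hy)
  apply le_antisymm
  · have hle : humbertPairOrder q q' ≤ S := by
      rw [humbertPairOrder, Algebra.adjoin_le_iff]
      rintro x (rfl | rfl)
      · exact mem_span_fam q q' 1
      · exact mem_span_fam q q' 2
    exact fun x hx ↦ hle hx
  · rw [Submodule.span_le]
    rintro x ⟨i, rfl⟩
    exact humbertPairFamInt_mem q q' i

/-- Membership form: every element of `ℤ[α, β]` is `c₀·1 + c₁α + c₂β + c₃αβ` with INTEGER `cᵢ`.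
[cite: Runge1999EndomorphismRingsAbelianSurfaces, §6 Thm. 7 (p. 294) and proof of Cor. 9 (p. 296)] -/
theorem exists_eq_comb_of_mem_humbertPairOrder {x : 𝕄ℤ} (hx : x ∈ humbertPairOrder q q') :
    ∃ c : Fin 4 → ℤ, x = ∑ i, c i • humbertPairFamInt q q' i := by
  have hx' : x ∈ Subalgebra.toSubmodule (humbertPairOrder q q') := hx
  rw [humbertPairOrder_toSubmodule_eq_span, Submodule.mem_span_range_iff_exists_fun] at hx'
  obtain ⟨c, hc⟩ := hx'
  exact ⟨c, hc.symm⟩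

/-- Conversely every integer combination lies in `ℤ[α, β]`. [cite: Runge1999EndomorphismRingsAbelianSurfaces, §6 Thm. 7 (p. 294)] -/
theorem comb_mem_humbertPairOrder (c : Fin 4 → ℤ) : ∑ i, c i • humbertPairFamInt q q' i ∈ humbertPairOrder q q' :=
  Subalgebra.sum_mem _ fun i _ ↦ Subalgebra.smul_mem _ (humbertPairFamInt_mem q q' i) _

end Order

/-! ## §2 Theorem 7's shape: `ℤ[α, β] = ℤ ⊕ ℤα ⊕ ℤβ ⊕ ℤαβ` (a `ℤ`-basis) when `det S_Δ ≠ 0` -/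

section Basis

variable {q q'}

/-- **`1, α, β, αβ` are linearly independent over `ℤ`** when `det S_Δ ≠ 0` (from the `ℚ`-independence of FILE 1 via the
injective cast `M₄(ℤ) → M₄(ℚ)`). [cite: Runge1999EndomorphismRingsAbelianSurfaces, §6 Thm. 7 (p. 294: "`R = ℤ ⊕ ℤα ⊕ ℤβ ⊕ ℤαβ`")] -/
theorem linearIndependent_humbertPairFamInt (hS : humbertInvariant q * humbertInvariant q' ≠ humbertPolar q q' ^ 2) :
    LinearIndependent ℤ (humbertPairFamInt q q') := by
  have hQ : LinearIndependent ℚ (humbertPairFam q q') := linearIndependent_humbertPairFam hS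
  have hZ : LinearIndependent ℤ (humbertPairFam q q') :=
    hQ.restrict_scalars (by
      intro a b h
      simpa using h)
  have hcomp : (castLin ∘ humbertPairFamInt q q') = humbertPairFam q q' := by
    funext i; exact (castLin_apply _).trans (map_humbertPairFamInt q q' i)
  exact LinearIndependent.of_comp castLin (hcomp ▸ hZ)

/-- **THEOREM 7's basis: `(1, α, β, αβ)` is a `ℤ`-basis of `ℤ[α, β]`** (`det S_Δ ≠ 0`), i.e.
`ℤ[α, β] = ℤ ⊕ ℤα ⊕ ℤβ ⊕ ℤαβ`. [cite: Runge1999EndomorphismRingsAbelianSurfaces, §6 Thm. 7 (p. 294: "`R = ℤ ⊕ ℤα ⊕ ℤβ ⊕ ℤαβ`")] -/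
def humbertPairOrderBasis (hS : humbertInvariant q * humbertInvariant q' ≠ humbertPolar q q' ^ 2) :
    Basis (Fin 4) ℤ (Subalgebra.toSubmodule (humbertPairOrder q q')) :=
  (Basis.span (linearIndependent_humbertPairFamInt hS)).map
    (LinearEquiv.ofEq _ _ (humbertPairOrder_toSubmodule_eq_span q q').symm)

/-- The basis vectors are `1, α, β, αβ`. [cite: Runge1999EndomorphismRingsAbelianSurfaces, §6 Thm. 7 (p. 294)] -/
@[simp] theorem coe_humbertPairOrderBasis_apply (hS : humbertInvariant q * humbertInvariant q' ≠ humbertPolar q q' ^ 2)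
    (i : Fin 4) : ((humbertPairOrderBasis hS i : Subalgebra.toSubmodule (humbertPairOrder q q')) : 𝕄ℤ) =
      humbertPairFamInt q q' i := by
  simp [humbertPairOrderBasis]

/-- `ℤ[α, β]` is a free `ℤ`-module … [cite: Runge1999EndomorphismRingsAbelianSurfaces, §6 Thm. 7 (p. 294)] -/
theorem free_humbertPairOrder (hS : humbertInvariant q * humbertInvariant q' ≠ humbertPolar q q' ^ 2) :
    Module.Free ℤ (Subalgebra.toSubmodule (humbertPairOrder q q')) :=
  Module.Free.of_basis (humbertPairOrderBasis hS)

/-- … finitely generated … [cite: Runge1999EndomorphismRingsAbelianSurfaces, §6 Thm. 7 (p. 294)] -/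
theorem finite_humbertPairOrder (hS : humbertInvariant q * humbertInvariant q' ≠ humbertPolar q q' ^ 2) :
    Module.Finite ℤ (Subalgebra.toSubmodule (humbertPairOrder q q')) :=
  Module.Finite.of_basis (humbertPairOrderBasis hS)

/-- **… of rank `4`: `rk_ℤ ℤ[α, β] = 4`.** [cite: Runge1999EndomorphismRingsAbelianSurfaces, §6 Thm. 7 (p. 294: "`R = ℤ ⊕ ℤα ⊕ ℤβ ⊕ ℤαβ`")] -/
theorem finrank_humbertPairOrder (hS : humbertInvariant q * humbertInvariant q' ≠ humbertPolar q q' ^ 2) :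
    finrank ℤ (Subalgebra.toSubmodule (humbertPairOrder q q')) = 4 := by
  rw [finrank_eq_card_basis (humbertPairOrderBasis hS), Fintype.card_fin]

/-- **`R = ℤ ⊕ ℤα ⊕ ℤβ ⊕ ℤαβ` as unique coordinates**: every element of `ℤ[α, β]` is `Σ cᵢxᵢ` for a UNIQUE `c ∈ ℤ⁴`.
[cite: Runge1999EndomorphismRingsAbelianSurfaces, §6 Thm. 7 (p. 294)] -/
theorem existsUnique_coords_of_mem_humbertPairOrder (hS : humbertInvariant q * humbertInvariant q' ≠ humbertPolar q q' ^ 2)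
    {x : 𝕄ℤ} (hx : x ∈ humbertPairOrder q q') : ∃! c : Fin 4 → ℤ, x = ∑ i, c i • humbertPairFamInt q q' i := by
  obtain ⟨c, hc⟩ := exists_eq_comb_of_mem_humbertPairOrder q q' hx
  refine ⟨c, hc, fun c' hc' ↦ ?_⟩
  have h := Fintype.linearIndependent_iff.1 (linearIndependent_humbertPairFamInt hS) (c' - c) (by
    simp only [Pi.sub_apply, sub_smul, Finset.sum_sub_distrib, ← hc, ← hc', sub_self])
  funext i; exact sub_eq_zero.1 (h i)

end Basis

/-! ## §3 "which generates the same quaternion algebra `ℚ(α, β) = R ⊗ ℚ`" -/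

section Rational

/-- Casting an integer combination of `(1, α, β, αβ)`. [folklore] -/
private theorem map_sum_smul_humbertPairFamInt (c : Fin 4 → ℤ) :
    (∑ i, c i • humbertPairFamInt q q' i).map (Int.cast : ℤ → ℚ) = ∑ i, (c i : ℚ) • humbertPairFam q q' i := by
  rw [← castLin_apply, map_sum]
  refine Finset.sum_congr rfl fun i _ ↦ ?_
  rw [map_zsmul, castLin_apply, map_humbertPairFamInt, Int.cast_smul_eq_zsmul]

/-- Clearing one denominator. [folklore] -/
private theorem exists_int_natCast_mul_eq (c : ℚ) {N : ℕ} (h : c.den ∣ N) : ∃ m : ℤ, (N : ℚ) * c = m := by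
  obtain ⟨k, hk⟩ := h
  refine ⟨k * c.num, ?_⟩
  rw [hk]; push_cast
  rw [mul_comm (c.den : ℚ) (k : ℚ), mul_assoc, Rat.den_mul_eq_num]

/-- **`ℤ[α, β] ⊆ ℚ(α, β)`** (after casting). [cite: Runge1999EndomorphismRingsAbelianSurfaces, §6 proof of Cor. 9 (p. 296)] -/
theorem map_mem_humbertPairAlg_of_mem {x : 𝕄ℤ} (hx : x ∈ humbertPairOrder q q') :
    x.map (Int.cast : ℤ → ℚ) ∈ humbertPairAlg q q' := by
  obtain ⟨c, rfl⟩ := exists_eq_comb_of_mem_humbertPairOrder q q' hx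
  rw [map_sum_smul_humbertPairFamInt]
  have hmem : ∑ i, (c i : ℚ) • humbertPairFam q q' i ∈ Submodule.span ℚ (Set.range (humbertPairFam q q')) :=
    Submodule.sum_mem _ fun i _ ↦ Submodule.smul_mem _ _ (Submodule.subset_span ⟨i, rfl⟩)
  rw [span_range_humbertPairFam] at hmem
  exact hmem

/-- **`ℤ[α, β]` is a FULL lattice in `ℚ(α, β)`: every element of `ℚ(α, β)` has a non-zero integer multiple in (the image
of) `ℤ[α, β]`** — "generates the same quaternion algebra". [cite: Runge1999EndomorphismRingsAbelianSurfaces, §6 proof of Cor. 9 (p. 296: "generates the same quaternion algebra `ℚ(α, β) = R ⊗ ℚ`")] -/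
theorem exists_int_smul_eq_map_of_mem_humbertPairAlg {x : 𝕄} (hx : x ∈ humbertPairAlg q q') :
    ∃ n : ℤ, n ≠ 0 ∧ ∃ y ∈ humbertPairOrder q q', (n : ℚ) • x = y.map (Int.cast : ℤ → ℚ) := by
  obtain ⟨c₀, c₁, c₂, c₃, rfl⟩ := exists_eq_comb_of_mem_humbertPairAlg q q' hx
  -- the coefficient vector and a common denominator
  set c : Fin 4 → ℚ := ![c₀, c₁, c₂, c₃] with hc
  let N : ℕ := c₀.den * c₁.den * c₂.den * c₃.den
  have hN : ∀ i, (c i).den ∣ N := by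
    intro i; fin_cases i
    · exact ⟨c₁.den * c₂.den * c₃.den, by simp [c, N]; ring⟩
    · exact ⟨c₀.den * c₂.den * c₃.den, by simp [c, N]; ring⟩
    · exact ⟨c₀.den * c₁.den * c₃.den, by simp [c, N]; ring⟩
    · exact ⟨c₀.den * c₁.den * c₂.den, by simp [c, N]; ring⟩
  choose m hm using fun i ↦ exists_int_natCast_mul_eq (c i) (hN i)
  refine ⟨(N : ℤ), by positivity, ∑ i, m i • humbertPairFamInt q q' i, comb_mem_humbertPairOrder q q' m, ?_⟩
  have hx : c₀ • (1 : 𝕄) + c₁ • (humbertRatRep q).map (Int.cast : ℤ → ℚ) + c₂ • (humbertRatRep q').map (Int.cast : ℤ → ℚ) +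
      c₃ • ((humbertRatRep q).map (Int.cast : ℤ → ℚ) * (humbertRatRep q').map (Int.cast : ℤ → ℚ)) =
      ∑ i, c i • humbertPairFam q q' i := by
    simp [c, humbertPairFam, Fin.sum_univ_four]
  rw [hx, map_sum_smul_humbertPairFamInt, Finset.smul_sum]
  refine Finset.sum_congr rfl fun i _ ↦ ?_
  rw [smul_smul, ← hm i]; push_cast; rfl

/-- **`ℚ·ℤ[α, β] = ℚ(α, β)`**: the `ℚ`-span of the image of the order is Runge's `ℚ(α, β)`.
[cite: Runge1999EndomorphismRingsAbelianSurfaces, §6 proof of Cor. 9 (p. 296: "`ℚ(α, β) = R ⊗ ℚ`")] -/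
theorem span_rat_map_humbertPairOrder :
    Submodule.span ℚ ((fun x : 𝕄ℤ ↦ x.map (Int.cast : ℤ → ℚ)) '' (humbertPairOrder q q' : Set 𝕄ℤ)) =
      Subalgebra.toSubmodule (humbertPairAlg q q') := by
  apply le_antisymm
  · rw [Submodule.span_le]
    rintro _ ⟨x, hx, rfl⟩
    exact map_mem_humbertPairAlg_of_mem q q' hx
  · rw [← span_range_humbertPairFam, Submodule.span_le]
    rintro _ ⟨i, rfl⟩
    exact Submodule.subset_span ⟨humbertPairFamInt q q' i, humbertPairFamInt_mem q q' i, map_humbertPairFamInt q q' i⟩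

end Rational

/-! ## §4 The discriminant `d(ℤ[α, β]) = det(S_Δ)/4` -/

section Discriminant

/-- **`d(ℤ[α, β]) := det(S_Δ)/4`** as an INTEGER (`= −γ² = −gammaSq q q′`; `four_mul_pairDiscr`): Runge's discriminant of
the order `R = ℤ ⊕ ℤα ⊕ ℤβ ⊕ ℤαβ`, whose square is `d(1, α, β, αβ)² = −det(t(xᵢxⱼ))` (`pairDiscr_sq_eq_rungeDiscrSq`) and
which is positive at every point of `H_q ∩ H_{q′}` (`pairDiscr_pos`, "we always choose the positive sign").
[cite: Runge1999EndomorphismRingsAbelianSurfaces, §6 Thm. 7 (p. 295: "The discriminant of `R` is `d(R) = det(S_Δ)/4`")] -/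
def pairDiscr (q q' : Fin 5 → ℤ) : ℤ := -gammaSq q q'

/-- **`4·d = det S_Δ`.** [cite: Runge1999EndomorphismRingsAbelianSurfaces, §6 Thm. 7 (p. 295)] -/
theorem four_mul_pairDiscr : 4 * pairDiscr q q' = (discMatrix q q').det := by
  rw [pairDiscr, det_discMatrix, mul_neg, four_mul_gammaSq]; ring

/-- `d = det(S_Δ)/4` in `ℚ`. [cite: Runge1999EndomorphismRingsAbelianSurfaces, §6 Thm. 7 (p. 295: "`d(R) = det(S_Δ)/4`")] -/
theorem pairDiscr_eq_det_div_four : (pairDiscr q q' : ℚ) = ((discMatrix q q').det : ℚ) / 4 := by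
  rw [← four_mul_pairDiscr]; push_cast; ring

/-- **`d² = d(1, α, β, αβ)² = −det(t(xᵢxⱼ))`** (FILE 1's `rungeDiscrSq`). [cite: Runge1999EndomorphismRingsAbelianSurfaces, §6 p. 294 and Thm. 7 (p. 295)] -/
theorem pairDiscr_sq_eq_rungeDiscrSq : ((pairDiscr q q' : ℤ) : ℚ) ^ 2 = rungeDiscrSq (humbertPairFam q q') := by
  rw [rungeDiscrSq_humbertPairFam_eq_gammaSq_sq, pairDiscr]; push_cast; ring

/-- `d` is symmetric in the two relations. [cite: Runge1999EndomorphismRingsAbelianSurfaces, §6 Thm. 7 (p. 295)] -/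
theorem pairDiscr_comm : pairDiscr q q' = pairDiscr q' q := by
  rw [pairDiscr, pairDiscr, gammaSq_comm]

/-- `γ² = −d·1` in `M₄(ℤ)` (Runge: "admissible if and only if `γ² … is a negative number`").
[cite: Runge1999EndomorphismRingsAbelianSurfaces, §6 proof of Thm. 7 (p. 295)] -/
theorem humbertComm_mul_self_eq_neg_pairDiscr :
    humbertComm q q' * humbertComm q q' = (-pairDiscr q q') • (1 : 𝕄ℤ) := by
  rw [pairDiscr, neg_neg, humbertComm_mul_self]

variable {q q'} {Z : siegelUpperHalfSpace 2}

/-- **"the positive sign": `d(ℤ[α, β]) = det(S_Δ)/4 > 0` at every point of `H_q ∩ H_{q′}`** (`q, q′` independent), since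
`S_Δ` is positive definite there (row A4-66 FILE 3). [cite: Runge1999EndomorphismRingsAbelianSurfaces, §6 Thm. 7 (p. 295)] -/
theorem pairDiscr_pos (h₀ : Z ∈ humbertLocus (fun i ↦ (q i : ℂ))) (h₁ : Z ∈ humbertLocus (fun i ↦ (q' i : ℂ)))
    (hli : LinearIndependent ℚ ![(fun i ↦ (q i : ℚ)), (fun i ↦ (q' i : ℚ))]) : 0 < pairDiscr q q' := by
  have h := det_discMatrix_pos' h₀ h₁ hli
  rw [← four_mul_pairDiscr] at h
  linarith

/-- On `H_q ∩ H_{q′}`: `γ²` is a NEGATIVE scalar (Runge's admissibility of `ℚ(α, β)`).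
[cite: Runge1999EndomorphismRingsAbelianSurfaces, §6 proof of Thm. 7 (p. 295: "`R ⊗ ℚ` is admissible if and only if `γ² = −n(γ) = (Δ(α,β)² − Δ(α)Δ(β))/4` is a negative number")] -/
theorem gammaSq_neg (h₀ : Z ∈ humbertLocus (fun i ↦ (q i : ℂ))) (h₁ : Z ∈ humbertLocus (fun i ↦ (q' i : ℂ)))
    (hli : LinearIndependent ℚ ![(fun i ↦ (q i : ℚ)), (fun i ↦ (q' i : ℚ))]) : gammaSq q q' < 0 := by
  have h := pairDiscr_pos h₀ h₁ hli
  rw [pairDiscr] at h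
  linarith

/-- **`d(ℤ[α, β]) = det(S_Δ)/4 ∈ ℕ_{>0}` with `d² = −det(t(xᵢxⱼ))`** on `H_q ∩ H_{q′}` — THEOREM 7's discriminant
statement for the order generated by the pair. [cite: Runge1999EndomorphismRingsAbelianSurfaces, §6 Thm. 7 (p. 295: "`d(R) = det(S_Δ)/4`")] -/
theorem exists_nat_pairDiscr (h₀ : Z ∈ humbertLocus (fun i ↦ (q i : ℂ))) (h₁ : Z ∈ humbertLocus (fun i ↦ (q' i : ℂ)))
    (hli : LinearIndependent ℚ ![(fun i ↦ (q i : ℚ)), (fun i ↦ (q' i : ℚ))]) :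
    ∃ d : ℕ, 0 < d ∧ 4 * (d : ℤ) = (discMatrix q q').det ∧ ((d : ℚ)) ^ 2 = rungeDiscrSq (humbertPairFam q q') := by
  have hpos := pairDiscr_pos h₀ h₁ hli
  obtain ⟨d, hd⟩ := Int.eq_ofNat_of_zero_le hpos.le
  refine ⟨d, by omega, ?_, ?_⟩
  · rw [← hd, four_mul_pairDiscr]
  · rw [← pairDiscr_sq_eq_rungeDiscrSq, hd]; push_cast; ring

end Discriminant

/-! ## §5 On `𝔥₂`: `ℤ[α, β] ⊆ ρ_r(End(X_Z)) ⟺ Z ∈ H_q ∩ H_{q′}` -/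

section Siegel

variable (Z : siegelUpperHalfSpace 2)

/-- **`ℤ[α, β] ⊆ ρ_r(End(X_Z)) ⟺ Z ∈ H_q ∩ H_{q′}`** (`End(X_Z)` in the rational representation is row A2-31's subring
`endRingInt (prinPeriod Z) ⊆ M₄(ℤ)`; B–W Cor. 4.2 for each generator, row A4-59′ `humbertRatRep_mem_endRingInt_iff`).
[cite: BirkenhakeWilhelm2003, §4 Cor. 4.2 (p. 1827)] [cite: Runge1999EndomorphismRingsAbelianSurfaces, §6 proof of Cor. 9 (p. 296: "generate an order contained in `R`")] -/
theorem humbertPairOrder_le_endRingInt_iff :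
    (∀ x ∈ humbertPairOrder q q', x ∈ endRingInt (prinPeriod Z : (Fin 2 ⊕ Fin 2 → ℝ) ≃L[ℝ] (Fin 2 → ℂ))) ↔
      Z ∈ humbertLocus (fun i ↦ (q i : ℂ)) ∧ Z ∈ humbertLocus (fun i ↦ (q' i : ℂ)) := by
  constructor
  · intro h
    exact ⟨(humbertRatRep_mem_endRingInt_iff q Z).1 (h _ (humbertRatRep_mem_humbertPairOrder_left q q')),
      (humbertRatRep_mem_endRingInt_iff q' Z).1 (h _ (humbertRatRep_mem_humbertPairOrder_right q q'))⟩
  · rintro ⟨h₀, h₁⟩ x hx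
    obtain ⟨c, rfl⟩ := exists_eq_comb_of_mem_humbertPairOrder q q' hx
    have hα := (humbertRatRep_mem_endRingInt_iff q Z).2 h₀
    have hβ := (humbertRatRep_mem_endRingInt_iff q' Z).2 h₁
    have hmem : ∀ i, humbertPairFamInt q q' i ∈ endRingInt (prinPeriod Z : (Fin 2 ⊕ Fin 2 → ℝ) ≃L[ℝ] (Fin 2 → ℂ)) := by
      intro i; fin_cases i
      · exact one_mem _
      · exact hα
      · exact hβ
      · exact mul_mem hα hβ
    exact sum_mem fun i _ ↦ zsmul_mem (hmem i) (c i)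

variable {Z} {q q'}

/-- On `H_q ∩ H_{q′}` every element of `ℤ[α, β]` is the rational representation of an endomorphism of `X_Z`.
[cite: BirkenhakeWilhelm2003, §4 Cor. 4.2 (p. 1827)] -/
theorem mem_endRingInt_of_mem_humbertPairOrder (h₀ : Z ∈ humbertLocus (fun i ↦ (q i : ℂ)))
    (h₁ : Z ∈ humbertLocus (fun i ↦ (q' i : ℂ))) {x : 𝕄ℤ} (hx : x ∈ humbertPairOrder q q') :
    x ∈ endRingInt (prinPeriod Z : (Fin 2 ⊕ Fin 2 → ℝ) ≃L[ℝ] (Fin 2 → ℂ)) :=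
  (humbertPairOrder_le_endRingInt_iff q q' Z).2 ⟨h₀, h₁⟩ x hx

/-- Conversely, if `ℤ[α, β] ⊆ ρ_r(End(X_Z))` then `Z` lies on both Humbert surfaces.
[cite: BirkenhakeWilhelm2003, §4 Cor. 4.2 (p. 1827)] -/
theorem mem_humbertLocus_of_humbertPairOrder_le
    (h : ∀ x ∈ humbertPairOrder q q', x ∈ endRingInt (prinPeriod Z : (Fin 2 ⊕ Fin 2 → ℝ) ≃L[ℝ] (Fin 2 → ℂ))) :
    Z ∈ humbertLocus (fun i ↦ (q i : ℂ)) ∧ Z ∈ humbertLocus (fun i ↦ (q' i : ℂ)) :=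
  (humbertPairOrder_le_endRingInt_iff q q' Z).1 h

/-- Independent relations have `det S_Δ ≠ 0` on `H_q ∩ H_{q′}`. [cite: Runge1999EndomorphismRingsAbelianSurfaces, §6 Thm. 7 (p. 295)] -/
theorem det_ne_of_mem_inter (h₀ : Z ∈ humbertLocus (fun i ↦ (q i : ℂ))) (h₁ : Z ∈ humbertLocus (fun i ↦ (q' i : ℂ)))
    (hli : LinearIndependent ℚ ![(fun i ↦ (q i : ℚ)), (fun i ↦ (q' i : ℚ))]) :
    humbertInvariant q * humbertInvariant q' ≠ humbertPolar q q' ^ 2 :=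
  fun h ↦ (det_discMatrix_pos h₀ h₁ hli).ne' (sub_eq_zero.2 h)

/-- **THEOREM 7 for the order generated by two singular relations at a point of `H_q ∩ H_{q′}`** (`q, q′` independent over
`ℚ`): `ℤ[α, β] ⊆ ρ_r(End(X_Z))` is `ℤ ⊕ ℤα ⊕ ℤβ ⊕ ℤαβ` (a `ℤ`-basis `(1, α, β, αβ)`, rank `4`), it spans the quaternion
algebra `ℚ(α, β) ⊆ End_ℚ(X_Z)`, and its discriminant is the positive integer `d = det(S_Δ)/4` with
`d² = −det(t(xᵢxⱼ))`. [cite: Runge1999EndomorphismRingsAbelianSurfaces, §6 Thm. 7 (pp. 294–295) and proof of Cor. 9 (p. 296)] -/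
theorem humbertPairOrder_summary (h₀ : Z ∈ humbertLocus (fun i ↦ (q i : ℂ))) (h₁ : Z ∈ humbertLocus (fun i ↦ (q' i : ℂ)))
    (hli : LinearIndependent ℚ ![(fun i ↦ (q i : ℚ)), (fun i ↦ (q' i : ℚ))]) :
    (∀ x ∈ humbertPairOrder q q', x ∈ endRingInt (prinPeriod Z : (Fin 2 ⊕ Fin 2 → ℝ) ≃L[ℝ] (Fin 2 → ℂ))) ∧
      (∀ i, ((humbertPairOrderBasis (det_ne_of_mem_inter h₀ h₁ hli) i :
        Subalgebra.toSubmodule (humbertPairOrder q q')) : 𝕄ℤ) = humbertPairFamInt q q' i) ∧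
      finrank ℤ (Subalgebra.toSubmodule (humbertPairOrder q q')) = 4 ∧
      humbertPairAlg q q' ≤ endAlgRat (prinPeriod Z : (Fin 2 ⊕ Fin 2 → ℝ) ≃L[ℝ] (Fin 2 → ℂ)) ∧
      0 < pairDiscr q q' ∧ 4 * pairDiscr q q' = (discMatrix q q').det ∧
      ((pairDiscr q q' : ℤ) : ℚ) ^ 2 = rungeDiscrSq (humbertPairFam q q') :=
  ⟨fun _ hx ↦ mem_endRingInt_of_mem_humbertPairOrder h₀ h₁ hx,
    coe_humbertPairOrderBasis_apply (det_ne_of_mem_inter h₀ h₁ hli),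
    finrank_humbertPairOrder (det_ne_of_mem_inter h₀ h₁ hli), humbertPairAlg_le_endAlgRat h₀ h₁, pairDiscr_pos h₀ h₁ hli,
    four_mul_pairDiscr q q', pairDiscr_sq_eq_rungeDiscrSq q q'⟩

end Siegel

/-! ## §6 Complements to FILE 1 on `ℚ(α, β)`: "`n` is multiplicative", `x ↦ x̄` is an anti-involution, `n(x, y)·1 = xȳ + yx̄` -/

section Involution

/-- **Runge's "main anti-involution" `x̄ = t(x) − x`** on `M₄(ℚ)` (an anti-involution on `ℚ(α, β)`: `rungeBar_mul_rev_of_mem`,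
`rungeBar_rungeBar`). [cite: Runge1999EndomorphismRingsAbelianSurfaces, §6 p. 294 ("The main anti-involution is defined by `x̄ = t(x) − x`")] -/
def rungeBar (x : 𝕄) : 𝕄 := rungeTrace x • (1 : 𝕄) - x

/-- Unfolding of `rungeBar`. [cite: Runge1999EndomorphismRingsAbelianSurfaces, §6 p. 294] -/
theorem rungeBar_def (x : 𝕄) : rungeBar x = rungeTrace x • (1 : 𝕄) - x := rfl

/-- `t(x̄) = t(x)`. [cite: Runge1999EndomorphismRingsAbelianSurfaces, §6 p. 294] -/
theorem rungeTrace_rungeBar (x : 𝕄) : rungeTrace (rungeBar x) = rungeTrace x := by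
  rw [rungeBar, map_sub, rungeTrace_smul_one]; ring

/-- `x̄̄ = x` (involutive). [cite: Runge1999EndomorphismRingsAbelianSurfaces, §6 p. 294] -/
theorem rungeBar_rungeBar (x : 𝕄) : rungeBar (rungeBar x) = x := by
  rw [rungeBar, rungeTrace_rungeBar, rungeBar]; abel

/-- `x̄` is `ℚ`-linear: `(x + y)‾ = x̄ + ȳ`. [cite: Runge1999EndomorphismRingsAbelianSurfaces, §6 p. 294] -/
theorem rungeBar_add (x y : 𝕄) : rungeBar (x + y) = rungeBar x + rungeBar y := by
  simp only [rungeBar, map_add, add_smul]; abel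

/-- `(c·1)‾ = c·1` (`ℚ` is fixed). [cite: Runge1999EndomorphismRingsAbelianSurfaces, §6 p. 294] -/
theorem rungeBar_smul_one (c : ℚ) : rungeBar (c • (1 : 𝕄)) = c • (1 : 𝕄) := by
  rw [rungeBar, rungeTrace_smul_one, ← sub_smul]; congr 1; ring

/-- `ℚ(α, β)` is stable under `x ↦ x̄`. [cite: Runge1999EndomorphismRingsAbelianSurfaces, §6 p. 294] -/
theorem rungeBar_mem {x : 𝕄} (hx : x ∈ humbertPairAlg q q') : rungeBar x ∈ humbertPairAlg q q' :=
  sub_mem (Subalgebra.smul_mem _ (one_mem _) _) hx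

variable {q q'}

/-- **`x x̄ = x̄ x = n(x)·1`** on `ℚ(α, β)` (FILE 1, restated with `rungeBar`). [cite: Runge1999EndomorphismRingsAbelianSurfaces, §6 p. 294 ("`n(x, x) = 2n(x) = 2xx̄`")] -/
theorem mul_rungeBar {x : 𝕄} (hx : x ∈ humbertPairAlg q q') : x * rungeBar x = rungeNorm x • (1 : 𝕄) :=
  mul_rungeBar_of_mem hx

/-- **"`n(x, y) = … = xȳ + yx̄`"** on `ℚ(α, β)`. [cite: Runge1999EndomorphismRingsAbelianSurfaces, §6 p. 294] -/
theorem mul_rungeBar_add_mul_rungeBar {x y : 𝕄} (hx : x ∈ humbertPairAlg q q') (hy : y ∈ humbertPairAlg q q') :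
    x * rungeBar y + y * rungeBar x = rungeNormPolar x y • (1 : 𝕄) := by
  have h := mul_add_mul_eq_of_mem hx hy
  have e : x * rungeBar y + y * rungeBar x = rungeTrace y • x + rungeTrace x • y - (x * y + y * x) := by
    simp only [rungeBar, mul_sub, mul_smul_comm, mul_one]; abel
  rw [e, h]; module

/-- **`x ↦ x̄` is an ANTI-involution on `ℚ(α, β)`: `(xy)‾ = ȳ x̄`** (equivalent to Lemma 8's identity for the pair).
[cite: Runge1999EndomorphismRingsAbelianSurfaces, §6 p. 294 ("The main anti-involution")] -/
theorem rungeBar_mul_rev_of_mem {x y : 𝕄} (hx : x ∈ humbertPairAlg q q') (hy : y ∈ humbertPairAlg q q') :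
    rungeBar (x * y) = rungeBar y * rungeBar x := by
  have h := mul_add_mul_eq_of_mem hx hy
  have hyx : y * x = rungeTrace x • y + rungeTrace y • x - rungeNormPolar x y • (1 : 𝕄) - x * y :=
    eq_sub_of_add_eq' h
  have ht : rungeTrace (x * y) = rungeTrace x * rungeTrace y - rungeNormPolar x y := by
    rw [rungeNormPolar_eq]; ring
  have e : rungeBar y * rungeBar x =
      (rungeTrace y * rungeTrace x) • (1 : 𝕄) - rungeTrace y • x - rungeTrace x • y + y * x := by
    simp only [rungeBar, sub_mul, mul_sub, smul_mul_assoc, mul_smul_comm, one_mul, mul_one]; module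
  rw [e, hyx, rungeBar, ht]
  module

/-- **"The map `n : A → ℚ` is multiplicative": `n(xy) = n(x)n(y)`** on `A = ℚ(α, β)` (`n(xy)·1 = xy ȳ x̄ = n(y) x x̄`).
[cite: Runge1999EndomorphismRingsAbelianSurfaces, §6 p. 294] -/
theorem rungeNorm_mul_of_mem {x y : 𝕄} (hx : x ∈ humbertPairAlg q q') (hy : y ∈ humbertPairAlg q q') :
    rungeNorm (x * y) = rungeNorm x * rungeNorm y := by
  have hxy : x * y ∈ humbertPairAlg q q' := mul_mem hx hy
  have h1 : (x * y) * rungeBar (x * y) = rungeNorm (x * y) • (1 : 𝕄) := mul_rungeBar_of_mem hxy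
  have h2 : (x * y) * rungeBar (x * y) = (rungeNorm x * rungeNorm y) • (1 : 𝕄) := by
    rw [rungeBar_mul_rev_of_mem hx hy, show x * y * (rungeBar y * rungeBar x) = x * (y * rungeBar y) * rungeBar x by
      simp only [mul_assoc], mul_rungeBar hy, mul_smul_comm, mul_one, smul_mul_assoc, mul_rungeBar hx,
      smul_smul, mul_comm (rungeNorm y)]
  have h := h1.symm.trans h2
  have hone : (1 : 𝕄) ≠ 0 := one_ne_zero
  exact smul_left_injective ℚ hone h

/-- `n(x̄) = n(x)` (for every `x ∈ M₄(ℚ)`). [cite: Runge1999EndomorphismRingsAbelianSurfaces, §6 p. 294] -/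
theorem rungeNorm_rungeBar (x : 𝕄) : rungeNorm (rungeBar x) = rungeNorm x := by
  have hsq : rungeBar x * rungeBar x = (rungeTrace x * rungeTrace x) • (1 : 𝕄) - (2 * rungeTrace x) • x + x * x := by
    simp only [rungeBar, sub_mul, mul_sub, smul_mul_assoc, mul_smul_comm, one_mul, mul_one]; module
  rw [rungeNorm_def, rungeNorm_def, rungeTrace_rungeBar, hsq, map_add, map_sub, map_smul, map_smul, rungeTrace_one,
    smul_eq_mul, smul_eq_mul]
  ring

end Involution

/-! ## §7 `ℚ(α, β) ∩ M₄(ℤ)` -/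

section AlgInt

variable (q q' : Fin 5 → ℤ)

/-- **`ℚ(α, β) ∩ M₄(ℤ)`**: the integer matrices whose image in `M₄(ℚ)` lies in Runge's `ℚ(α, β) = humbertPairAlg q q′` — a
subring of `M₄(ℤ)` containing `ℤ[α, β]` (Runge: a QCM-order is `R = R ⊗ ℚ ∩ M₄(ℤ)`).
[cite: Runge1999EndomorphismRingsAbelianSurfaces, §6 p. 294 ("`R = L ∩ M₄(ℤ)`") and proof of Thm. 7 (p. 295: "`ℚ(α, β) ∩ M₄(ℤ)`")] -/
def humbertPairAlgInt (q q' : Fin 5 → ℤ) : Subring (Matrix (Fin 2 ⊕ Fin 2) (Fin 2 ⊕ Fin 2) ℤ) :=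
  (humbertPairAlg q q').toSubring.comap (Int.castRingHom ℚ).mapMatrix

/-- Membership: `x ∈ ℚ(α, β) ∩ M₄(ℤ) ⟺ x_ℚ ∈ ℚ(α, β)`. [cite: Runge1999EndomorphismRingsAbelianSurfaces, §6 proof of Thm. 7 (p. 295)] -/
theorem mem_humbertPairAlgInt_iff {x : 𝕄ℤ} :
    x ∈ humbertPairAlgInt q q' ↔ x.map (Int.cast : ℤ → ℚ) ∈ humbertPairAlg q q' := by
  rw [humbertPairAlgInt, Subring.mem_comap, RingHom.mapMatrix_apply, Subalgebra.mem_toSubring]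
  rfl

/-- **`ℤ[α, β] ⊆ ℚ(α, β) ∩ M₄(ℤ)`** for every pair of relations. [cite: Runge1999EndomorphismRingsAbelianSurfaces, §6 proof of Cor. 9 (p. 296: "generate an order contained in `R`")] -/
theorem humbertPairOrder_le_humbertPairAlgInt {x : 𝕄ℤ} (hx : x ∈ humbertPairOrder q q') :
    x ∈ humbertPairAlgInt q q' :=
  (mem_humbertPairAlgInt_iff q q').2 (map_mem_humbertPairAlg_of_mem q q' hx)

/-- The same containment for subrings. [cite: Runge1999EndomorphismRingsAbelianSurfaces, §6 proof of Cor. 9 (p. 296)] -/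
theorem humbertPairOrder_toSubring_le_humbertPairAlgInt :
    (humbertPairOrder q q').toSubring ≤ humbertPairAlgInt q q' :=
  fun _ hx ↦ humbertPairOrder_le_humbertPairAlgInt q q' hx

/-- `ℚ(α, β) ∩ M₄(ℤ)` is symmetric in the two relations. [cite: Runge1999EndomorphismRingsAbelianSurfaces, §6 proof of Thm. 7 (p. 295)] -/
theorem humbertPairAlgInt_comm : humbertPairAlgInt q q' = humbertPairAlgInt q' q := by
  rw [humbertPairAlgInt, humbertPairAlgInt, humbertPairAlg_comm]

end AlgInt

/-! ## §8 Runge's "easy check": `g.c.d.(b, c) = 1 ⟹ ℚ(α, β) ∩ M₄(ℤ) = ℤ ⊕ ℤα ⊕ ℤβ ⊕ ℤαβ` -/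

section Saturation

variable (k l : ℤ) (q' : Fin 5 → ℤ)

/-- `α = R₀(q₀)` for Humbert's normal form `q₀ = (k, l, −1, 0, 0)`, over `ℚ`. -/
local notation "α" => Matrix.map (humbertRatRep (humbertNormalForm k l)) (Int.cast : ℤ → ℚ)
/-- `β = R₀(q′)` over `ℚ`. -/
local notation "β" => Matrix.map (humbertRatRep q') (Int.cast : ℤ → ℚ)

/-- The six entries of `c₀·1 + c₁α + c₂β + c₃αβ` that determine the coefficients, for `α` in normal form: positions
`(x₂, y₂) ↦ c₃d′`, `(x₁, y₂) ↦ c₂d′`, `(y₁, x₂) ↦ c₂e′`, `(y₁, x₁) ↦ −c₃e′`, `(x₂, x₁) ↦ c₁ − c′(c₂ + lc₃)`,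
`(x₁, x₁) ↦ c₀ − kc′c₃`. [cite: Runge1999EndomorphismRingsAbelianSurfaces, §6 proof of Thm. 7 (p. 295: "it is easy to check")] -/
theorem comb_normalForm_entries (c₀ c₁ c₂ c₃ : ℚ) :
    let M : 𝕄 := c₀ • (1 : 𝕄) + c₁ • α + c₂ • β + c₃ • (α * β)
    M (inl 1) (inr 1) = c₃ * q' 3 ∧ M (inl 0) (inr 1) = c₂ * q' 3 ∧ M (inr 0) (inl 1) = c₂ * q' 4 ∧
      M (inr 0) (inl 0) = -(c₃ * q' 4) ∧ M (inl 1) (inl 0) = c₁ - q' 2 * (c₂ + l * c₃) ∧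
      M (inl 0) (inl 0) = c₀ - k * q' 2 * c₃ := by
  refine ⟨?_, ?_, ?_, ?_, ?_, ?_⟩ <;>
    simp [humbertRatRep, humbertNormalForm, Matrix.mul_apply, Fintype.sum_sum_type, Fin.sum_univ_two,
      Matrix.map_apply] <;> ring

/-- **Runge's criterion, membership form**: if `g.c.d.(d′, e′) = 1` then every INTEGER matrix of `ℚ(α, β)`
(`α = R₀(humbertNormalForm k l)`) lies in `ℤ[α, β]` — its coordinates `c₀, …, c₃` are integers.
[cite: Runge1999EndomorphismRingsAbelianSurfaces, §6 proof of Thm. 7 (p. 295: "`g.c.d.(b, c) = 1` for a basis `(α, β)` implies that `ℚ(α, β) ∩ M₄(ℤ) = ℤ ⊕ ℤα ⊕ ℤβ ⊕ ℤαβ`")] -/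
theorem mem_humbertPairOrder_of_map_mem_humbertPairAlg (hcop : IsCoprime (q' 3) (q' 4)) {x : 𝕄ℤ}
    (hx : x.map (Int.cast : ℤ → ℚ) ∈ humbertPairAlg (humbertNormalForm k l) q') :
    x ∈ humbertPairOrder (humbertNormalForm k l) q' := by
  obtain ⟨c₀, c₁, c₂, c₃, hM⟩ := exists_eq_comb_of_mem_humbertPairAlg _ _ hx
  obtain ⟨e₁, e₂, e₃, e₄, e₅, e₆⟩ := comb_normalForm_entries k l q' c₀ c₁ c₂ c₃
  simp only [← hM, Matrix.map_apply] at e₁ e₂ e₃ e₄ e₅ e₆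
  obtain ⟨u, v, huv⟩ := hcop
  have huvQ : (u : ℚ) * q' 3 + v * q' 4 = 1 := by exact_mod_cast huv
  -- the coefficients are integers
  have hc₃ : c₃ = ((u * x (inl 1) (inr 1) - v * x (inr 0) (inl 0) : ℤ) : ℚ) := by
    push_cast
    linear_combination (-(u : ℚ)) * e₁ + (v : ℚ) * e₄ - c₃ * huvQ
  have hc₂ : c₂ = ((u * x (inl 0) (inr 1) + v * x (inr 0) (inl 1) : ℤ) : ℚ) := by
    push_cast
    linear_combination (-(u : ℚ)) * e₂ - (v : ℚ) * e₃ - c₂ * huvQ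
  set m₃ : ℤ := u * x (inl 1) (inr 1) - v * x (inr 0) (inl 0) with hm₃
  set m₂ : ℤ := u * x (inl 0) (inr 1) + v * x (inr 0) (inl 1) with hm₂
  have hc₁ : c₁ = ((x (inl 1) (inl 0) + q' 2 * (m₂ + l * m₃) : ℤ) : ℚ) := by
    push_cast
    rw [← hc₂, ← hc₃]
    linear_combination (-1 : ℚ) * e₅
  have hc₀ : c₀ = ((x (inl 0) (inl 0) + k * q' 2 * m₃ : ℤ) : ℚ) := by
    push_cast
    rw [← hc₃]
    linear_combination (-1 : ℚ) * e₆
  set m₁ : ℤ := x (inl 1) (inl 0) + q' 2 * (m₂ + l * m₃) with hm₁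
  set m₀ : ℤ := x (inl 0) (inl 0) + k * q' 2 * m₃ with hm₀
  -- hence `x = m₀·1 + m₁α + m₂β + m₃αβ` over `ℤ`
  have hxZ : x = m₀ • (1 : 𝕄ℤ) + m₁ • humbertRatRep (humbertNormalForm k l) + m₂ • humbertRatRep q' +
      m₃ • (humbertRatRep (humbertNormalForm k l) * humbertRatRep q') := by
    apply castQ_injective
    simp only [castQ_add, castQ_smul, castQ_mul, castQ_one]
    rw [hM, hc₀, hc₁, hc₂, hc₃]
  rw [hxZ]
  exact add_mem (add_mem (add_mem (Subalgebra.smul_mem _ (one_mem _) _)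
    (Subalgebra.smul_mem _ (humbertRatRep_mem_humbertPairOrder_left _ _) _))
    (Subalgebra.smul_mem _ (humbertRatRep_mem_humbertPairOrder_right _ _) _))
    (Subalgebra.smul_mem _ (humbertRatRep_mul_mem_humbertPairOrder _ _) _)

/-- **RUNGE: "`g.c.d.(b, c) = 1` for a basis `(α, β)` implies that `ℚ(α, β) ∩ M₄(ℤ) = ℤ ⊕ ℤα ⊕ ℤβ ⊕ ℤαβ`"** — membership
equivalence, `α` in Humbert's normal form, `(b, c) = (d′, e′)` the antisymmetric-block entries of `β`.
[cite: Runge1999EndomorphismRingsAbelianSurfaces, §6 proof of Thm. 7 (p. 295)] -/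
theorem mem_humbertPairAlgInt_normalForm_iff (hcop : IsCoprime (q' 3) (q' 4)) {x : 𝕄ℤ} :
    x ∈ humbertPairAlgInt (humbertNormalForm k l) q' ↔ x ∈ humbertPairOrder (humbertNormalForm k l) q' :=
  ⟨fun hx ↦ mem_humbertPairOrder_of_map_mem_humbertPairAlg k l q' hcop ((mem_humbertPairAlgInt_iff _ _).1 hx),
    fun hx ↦ humbertPairOrder_le_humbertPairAlgInt _ _ hx⟩

/-- **`ℚ(α, β) ∩ M₄(ℤ) = ℤ[α, β]`** as subrings of `M₄(ℤ)` (`α` in normal form, `g.c.d.(d′, e′) = 1`).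
[cite: Runge1999EndomorphismRingsAbelianSurfaces, §6 proof of Thm. 7 (p. 295)] -/
theorem humbertPairAlgInt_normalForm_eq (hcop : IsCoprime (q' 3) (q' 4)) :
    humbertPairAlgInt (humbertNormalForm k l) q' = (humbertPairOrder (humbertNormalForm k l) q').toSubring :=
  Subring.ext fun _ ↦ mem_humbertPairAlgInt_normalForm_iff k l q' hcop

/-- With `det S_Δ ≠ 0` as well: **`ℚ(α, β) ∩ M₄(ℤ) = ℤ ⊕ ℤα ⊕ ℤβ ⊕ ℤαβ`** — every integer matrix of `ℚ(α, β)` has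
UNIQUE integer coordinates in `(1, α, β, αβ)`. [cite: Runge1999EndomorphismRingsAbelianSurfaces, §6 Thm. 7 and its proof (pp. 294–295)] -/
theorem existsUnique_coords_of_mem_humbertPairAlgInt (hcop : IsCoprime (q' 3) (q' 4))
    (hS : humbertInvariant (humbertNormalForm k l) * humbertInvariant q' ≠ humbertPolar (humbertNormalForm k l) q' ^ 2)
    {x : 𝕄ℤ} (hx : x ∈ humbertPairAlgInt (humbertNormalForm k l) q') :
    ∃! c : Fin 4 → ℤ, x = ∑ i, c i • humbertPairFamInt (humbertNormalForm k l) q' i :=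
  existsUnique_coords_of_mem_humbertPairOrder hS ((mem_humbertPairAlgInt_normalForm_iff k l q' hcop).1 hx)

end Saturation

/-! ## §9 On `𝔥₂`: `ρ_r(End(X_Z)) ∩ ℚ(α, β) = ℤ[α, β]`, and `End(X_Z) = ℤ ⊕ ℤα ⊕ ℤβ ⊕ ℤαβ` at the simple points -/

section SiegelSaturated

variable {k l : ℤ} {q' : Fin 5 → ℤ} {Z : siegelUpperHalfSpace 2}

/-- **`ρ_r(End(X_Z)) ∩ ℚ(α, β) = ℤ[α, β]`** at a point `Z ∈ H_{q₀} ∩ H_{q′}` (`q₀` Humbert's normal form,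
`g.c.d.(d′, e′) = 1`): the endomorphisms of `X_Z` lying in Runge's `ℚ(α, β)` are exactly `ℤ ⊕ ℤα ⊕ ℤβ ⊕ ℤαβ`.
[cite: Runge1999EndomorphismRingsAbelianSurfaces, §6 proof of Thm. 7 (p. 295) and proof of Cor. 9 (p. 296)] -/
theorem endRingInt_inf_humbertPairAlgInt_eq (h₀ : Z ∈ humbertLocus (fun i ↦ (humbertNormalForm k l i : ℂ)))
    (h₁ : Z ∈ humbertLocus (fun i ↦ (q' i : ℂ))) (hcop : IsCoprime (q' 3) (q' 4)) :
    endRingInt (prinPeriod Z : (Fin 2 ⊕ Fin 2 → ℝ) ≃L[ℝ] (Fin 2 → ℂ)) ⊓ humbertPairAlgInt (humbertNormalForm k l) q' =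
      (humbertPairOrder (humbertNormalForm k l) q').toSubring := by
  apply le_antisymm
  · rintro x ⟨-, hx⟩
    exact (mem_humbertPairAlgInt_normalForm_iff k l q' hcop).1 hx
  · intro x hx
    exact ⟨mem_endRingInt_of_mem_humbertPairOrder h₀ h₁ hx, humbertPairOrder_le_humbertPairAlgInt _ _ hx⟩

/-- If `End_ℚ(X_Z) = ℚ(α, β)` then `ρ_r(End(X_Z)) = ℚ(α, β) ∩ M₄(ℤ)` (Runge's "`R = R ⊗ ℚ ∩ M₄(ℤ)`" for `R = End(X)`).
[cite: Runge1999EndomorphismRingsAbelianSurfaces, §6 p. 294 ("`R = L ∩ M₄(ℤ)`")] -/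
theorem endRingInt_eq_humbertPairAlgInt_of_endAlgRat_eq {q q' : Fin 5 → ℤ}
    (h : endAlgRat (prinPeriod Z : (Fin 2 ⊕ Fin 2 → ℝ) ≃L[ℝ] (Fin 2 → ℂ)) = humbertPairAlg q q') :
    endRingInt (prinPeriod Z : (Fin 2 ⊕ Fin 2 → ℝ) ≃L[ℝ] (Fin 2 → ℂ)) = humbertPairAlgInt q q' := by
  ext x
  rw [mem_endRingInt_iff, mem_humbertPairAlgInt_iff, h]

/-- **THEOREM 7 at a SIMPLE point of `H_{q₀} ∩ H_{q′}`** (`q₀` normal form, `q₀, q′` independent, `g.c.d.(d′, e′) = 1`):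
the QCM-order `ρ_r(End(X_Z))` IS `ℤ[α, β] = ℤ ⊕ ℤα ⊕ ℤβ ⊕ ℤαβ` (row A4-66 FILE 3: `End_ℚ(X_Z) = ℚ(α, β)` for simple
`X_Z`). [cite: Runge1999EndomorphismRingsAbelianSurfaces, §6 Thm. 7 (pp. 294–295) and p. 296 ("we have `End(A_τ) = R`")] -/
theorem endRingInt_eq_humbertPairOrder_of_isSimple
    (hX : IsSimple (prinPeriod Z : (Fin 2 ⊕ Fin 2 → ℝ) ≃L[ℝ] (Fin 2 → ℂ)))
    (h₀ : Z ∈ humbertLocus (fun i ↦ (humbertNormalForm k l i : ℂ))) (h₁ : Z ∈ humbertLocus (fun i ↦ (q' i : ℂ)))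
    (hli : LinearIndependent ℚ ![(fun i ↦ (humbertNormalForm k l i : ℚ)), (fun i ↦ (q' i : ℚ))])
    (hcop : IsCoprime (q' 3) (q' 4)) :
    endRingInt (prinPeriod Z : (Fin 2 ⊕ Fin 2 → ℝ) ≃L[ℝ] (Fin 2 → ℂ)) = (humbertPairOrder (humbertNormalForm k l) q').toSubring := by
  rw [endRingInt_eq_humbertPairAlgInt_of_endAlgRat_eq (endAlgRat_eq_humbertPairAlg_of_isSimple hX h₀ h₁ hli),
    humbertPairAlgInt_normalForm_eq k l q' hcop]

/-- **THEOREM 7 at a point of `H_{q₀} ∩ H_{q′}` with `ρ(X_Z) = 3`** (row A4-66 FILE 5: there `End_ℚ(X_Z) = ℚ(α, β)`):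
`ρ_r(End(X_Z)) = ℤ ⊕ ℤα ⊕ ℤβ ⊕ ℤαβ`. [cite: Runge1999EndomorphismRingsAbelianSurfaces, §6 Thm. 7 (pp. 294–295) and p. 296] -/
theorem endRingInt_eq_humbertPairOrder_of_finrank_eq_three
    (h₀ : Z ∈ humbertLocus (fun i ↦ (humbertNormalForm k l i : ℂ))) (h₁ : Z ∈ humbertLocus (fun i ↦ (q' i : ℂ)))
    (hli : LinearIndependent ℚ ![(fun i ↦ (humbertNormalForm k l i : ℚ)), (fun i ↦ (q' i : ℚ))])
    (h3 : finrank ℤ (neronSeveriGroup (prinPeriod Z : (Fin 2 ⊕ Fin 2 → ℝ) ≃L[ℝ] (Fin 2 → ℂ))) = 3)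
    (hcop : IsCoprime (q' 3) (q' 4)) :
    endRingInt (prinPeriod Z : (Fin 2 ⊕ Fin 2 → ℝ) ≃L[ℝ] (Fin 2 → ℂ)) = (humbertPairOrder (humbertNormalForm k l) q').toSubring := by
  rw [endRingInt_eq_humbertPairAlgInt_of_endAlgRat_eq (endAlgRat_eq_humbertPairAlg_of_finrank_eq_three h₀ h₁ hli h3),
    humbertPairAlgInt_normalForm_eq k l q' hcop]

/-- **THEOREM 7, assembled, for the QCM-order `R = ρ_r(End(X_Z))` at a simple point of `H_{q₀} ∩ H_{q′}`**: `R = ℤ[α, β]`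
has the `ℤ`-basis `(1, α, β, αβ)` ("`R = ℤ ⊕ ℤα ⊕ ℤβ ⊕ ℤαβ`"), `R ⊗ ℚ = ℚ(α, β) = End_ℚ(X_Z)`, and its discriminant is
the positive integer `d(R) = det(S_Δ)/4` with `d(R)² = −det(t(xᵢxⱼ))` ("The discriminant of `R` is `d(R) = det(S_Δ)/4`").
[cite: Runge1999EndomorphismRingsAbelianSurfaces, §6 Thm. 7 (pp. 294–295)] -/
theorem runge_theorem_seven_of_isSimple
    (hX : IsSimple (prinPeriod Z : (Fin 2 ⊕ Fin 2 → ℝ) ≃L[ℝ] (Fin 2 → ℂ)))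
    (h₀ : Z ∈ humbertLocus (fun i ↦ (humbertNormalForm k l i : ℂ))) (h₁ : Z ∈ humbertLocus (fun i ↦ (q' i : ℂ)))
    (hli : LinearIndependent ℚ ![(fun i ↦ (humbertNormalForm k l i : ℚ)), (fun i ↦ (q' i : ℚ))])
    (hcop : IsCoprime (q' 3) (q' 4)) :
    (∀ x : 𝕄ℤ, x ∈ endRingInt (prinPeriod Z : (Fin 2 ⊕ Fin 2 → ℝ) ≃L[ℝ] (Fin 2 → ℂ)) ↔
        ∃! c : Fin 4 → ℤ, x = ∑ i, c i • humbertPairFamInt (humbertNormalForm k l) q' i) ∧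
      endAlgRat (prinPeriod Z : (Fin 2 ⊕ Fin 2 → ℝ) ≃L[ℝ] (Fin 2 → ℂ)) = humbertPairAlg (humbertNormalForm k l) q' ∧
      0 < pairDiscr (humbertNormalForm k l) q' ∧
      4 * pairDiscr (humbertNormalForm k l) q' = (discMatrix (humbertNormalForm k l) q').det ∧
      ((pairDiscr (humbertNormalForm k l) q' : ℤ) : ℚ) ^ 2 = rungeDiscrSq (humbertPairFam (humbertNormalForm k l) q') := by
  have hS := det_ne_of_mem_inter h₀ h₁ hli
  refine ⟨fun x ↦ ?_, endAlgRat_eq_humbertPairAlg_of_isSimple hX h₀ h₁ hli, pairDiscr_pos h₀ h₁ hli,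
    four_mul_pairDiscr _ _, pairDiscr_sq_eq_rungeDiscrSq _ _⟩
  rw [endRingInt_eq_humbertPairOrder_of_isSimple hX h₀ h₁ hli hcop, Subalgebra.mem_toSubring]
  constructor
  · exact existsUnique_coords_of_mem_humbertPairOrder hS
  · rintro ⟨c, hc, -⟩
    rw [hc]; exact comb_mem_humbertPairOrder _ _ c

end SiegelSaturated

end SiegelModuli

end Literature.AlgebraicGeometry.ModuliOfAbelianVarieties
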